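import Summits.BirchSwinnertonDyer.Rank1Residual.X2.IsogenyPeriodRatio
import Summits.BirchSwinnertonDyer.Rank1Residual.Partition.EisensteinKernelInertiaLineMult
import Summits.BirchSwinnertonDyer.Rank1Residual.X2.IsogenyLineType
import Literature.NumberTheory.EllipticCurves.GreenbergVatsal2000.IsogenyClassPeriod
import Literature.NumberTheory.EllipticCurves.Rank1Residual.GVParityLineTypeProofs
import Literature.NumberTheory.EllipticCurves.Rank1Residual.GVParityOrdinaryLineProofs
import Literature.NumberTheory.EllipticCurves.Rank1Residual.GVParityIsogenyConjugationProofs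
import Literature.NumberTheory.EllipticCurves.Rank1Residual.GVParityIsogenyProofs
import Literature.NumberTheory.EllipticCurves.SkinnerUrban2014.PAdicUnitPeriodRatioAnyPrimeProofs
import Literature.NumberTheory.EllipticCurves.IsogenySeparableFactorProofs
import Literature.NumberTheory.EllipticCurves.IsogenyFactorProofs
import Literature.NumberTheory.EllipticCurves.IsogenyDualProofs
import Literature.NumberTheory.EllipticCurves.IsogenyPairParity
import Literature.NumberTheory.EllipticCurves.ModularCurveManinSemistableBridgeProofs
import Literature.NumberTheory.Automorphic.ShimuraCurveRibetTakahashiOptimalModularityProofs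
import Literature.NumberTheory.EllipticCurves.PointDivisibilityProofs
import Literature.NumberTheory.EllipticCurves.BinaryQuarticMinimisationPrimeProofs
import HarnessLib

/-!
# Greenberg–Vatsal 2000, Cor. (3.8), period clause — tools: complementary line types, the kernel of
# the dual, prime-to-`p` isogenies, factorisation (cell `b2b-bsdres`, unit `b2b-bsdres-lit-cgls`,
# GEN 16; file 1 of 2, continued in `Partition/GreenbergVatsalIsogenyClassPeriod.lean`)

HONEST FRAMING (run/shared/lean/b2b/bsd-rank1-residual/, verbatim in every file): the goal of the
cell is to DELETE the COMBINATION-SHAPED residual classes of the Birch–Swinnerton-Dyer formula for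
ALL analytic-rank `≤ 1` elliptic curves over `ℚ` — "full BSD formula for every rank `≤ 1` curve in
class `C`" assembled STRICTLY from published theorems — so that the rank-`≤ 1` remainder becomes
exactly the CONSTRUCTION-SHAPED classes, which are TYPED (missing-input `Prop`s), NOT attempted.
This is not "finishing BSD". NO CLAIM BEYOND STATED CLASSES; nothing here changes a label.
Theorems only; no definition, no named fact.

WHAT (file 1 of the kernel proof of the registered named fact A180
`GreenbergVatsal2000.cor38_realPeriodRat_eq_unit_mul_of_isIsogenous_of_gvPar`, Greenberg–Vatsal,
Invent. Math. 142 (2000), §3 Cor. (3.8), period clause; the induction and the discharge are file 2):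
* §0 (hL) at an odd prime of good ordinary OR multiplicative reduction — Serre's ordinary line
  (`exists_ordinaryLine_of_not_dvd_frobeniusTrace`) resp. the Tate-free inertia line
  (`KernelDisc.exists_inertiaLine_of_mult`) — and the transport of the reduction hypothesis along a
  `ℚ`-isogeny;
* §1 `unramified_odd_range_of_ramified_even_ker`: for a `Γ_ℚ`-equivariant `g : E[p] → E'[p]` whose
  kernel is a line RAMIFIED at `p` and EVEN, the image `g(E[p]) ≅ E[p]/ker g` is a rational line
  UNRAMIFIED at `p` and ODD (the converse direction of x1a's / `eisenstein-p2`'s CASE 2 ⇒ CASE 1;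
  the computation is the one inside `gvPar_of_ker_line`, which records only `GVPar W' p`);
* §2 for the restriction of a `ℚ`-isogeny to `E[p]` (`X2.IsogenyLineType.exists_restrict_torsion`):
  its kernel line, and `ker ψ̂ = ψ(E[p])` for a dual pair `ψ̂ ∘ ψ = [p]`;
* §3 `exists_unit_of_not_dvd_degree`: an isogeny of degree prime to `p` between globally minimal
  models changes the Néron real period by a `p`-adic unit (`q·Ω(E) = a·Ω(E')`, `q ∣ d`, `ab = d`,
  tree `SkinnerUrban2014.exists_int_mul_realPeriodRat_eq_of_isogeny` — Greenberg–Vatsal's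
  Remark (3.4) bookkeeping);
* §4 Silverman III.4.11 over `ℚ` (`exists_factor_of_ker_le`, every isogeny being separable in
  characteristic `0`), the kernel count `#ker ψ = #ker λ · #ker g` of a factorisation `ψ = λ ∘ g`,
  and "two isogenies with the same kernel differ by an isogeny of degree `1`".

References: [GreenbergVatsal2000] §3 Remark (3.4), Cor. (3.8) p. 40, §2 p. 28;
[SilvermanAEC2009] III.4.11, III.6.1–6.2, II.2.3, VI.4.1(b); [SerreInventiones1972] §1.11–1.12;
[MilneADT2006] I §7; HOME/b2b-bsdres-lit-cgls/CGLS-GV-TYPING.md §23.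
-/


set_option autoImplicit false

noncomputable section

open scoped Classical NumberField MatrixGroups ModularForm

open WeierstrassCurve CongruenceSubgroup Field IsDedekindDomain NumberField
  Literature.NumberTheory.EllipticCurves Literature.NumberTheory.EllipticCurves.Rank1Residual
  Literature.NumberTheory.EllipticCurves.ModularForms Literature.NumberTheory.GaloisRepresentations
  Literature.NumberTheory.EllipticCurves.GreenbergVatsal2000

namespace Summit.BirchSwinnertonDyer.Rank1Residual.GVPeriod

variable {W W' : WeierstrassCurve ℚ} {p : ℕ} [hp : Fact p.Prime]

/-! ## §0. Serre's line (hL) at an odd good-ordinary-or-multiplicative prime -/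

variable (W p) in
/-- **(hL) at an odd prime of good ordinary OR multiplicative reduction**: at every prime `𝔓` of
`\bar ℤ` above `p` there is a subgroup `L ≤ E[p]` of order `p` with `(σ - 1)E[p] ⊆ L` for all
`σ ∈ I_𝔓` and a point of `L` moved by `I_𝔓` — Serre's ordinary line
(`exists_ordinaryLine_of_not_dvd_frobeniusTrace`) resp. the Tate-free inertia line
(`KernelDisc.exists_inertiaLine_of_mult`). [cite: SerreInventiones1972, §1.11 Prop. 11 and Cor., §1.12] -/
theorem exists_inertiaLine_of_goodOrd_or_mult [W.IsElliptic] [W.IsGloballyMinimal] (hp2 : p ≠ 2)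
    (hred : (W.HasGoodReductionAtPrime p ∧ ¬ (p : ℤ) ∣ W.frobeniusTrace p) ∨
      W.HasMultiplicativeReductionAtPrime p) :
    ∀ (v : HeightOneSpectrum (𝓞 ℚ)), (p : 𝓞 ℚ) ∈ v.asIdeal → ∀ 𝔓 ∈ v.primesAbove,
      ∃ L : AddSubgroup (geomTorsion W (p : ℤ)), Nat.card L = p ∧
        (∀ σ ∈ 𝔓.inertia (absoluteGaloisGroup ℚ), ∀ P : geomTorsion W (p : ℤ), σ • P - P ∈ L) ∧
        (∃ σ ∈ 𝔓.inertia (absoluteGaloisGroup ℚ), ∃ P ∈ L, σ • P ≠ P) := by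
  rcases hred with ⟨hgood, hord⟩ | hmult
  · exact exists_ordinaryLine_of_not_dvd_frobeniusTrace W hp2 hgood hord
  · exact KernelDisc.exists_inertiaLine_of_mult W p hp2 hmult

/-- Transport of "good ordinary or multiplicative at `p`" along a `ℚ`-isogeny of globally minimal
curves (`IsIsogenous.hasGoodReductionAtPrime_iff`, `….not_dvd_frobeniusTrace_iff`,
`hasMultiplicativeReductionAtPrime_of_isIsogenous`). [cite: SilvermanAEC2009, Cor. VII.7.2] -/
theorem goodOrd_or_mult_of_isIsogenous [W.IsElliptic] [W'.IsElliptic] [W.IsGloballyMinimal]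
    [W'.IsGloballyMinimal] (h : IsIsogenous W W')
    (hred : (W.HasGoodReductionAtPrime p ∧ ¬ (p : ℤ) ∣ W.frobeniusTrace p) ∨
      W.HasMultiplicativeReductionAtPrime p) :
    (W'.HasGoodReductionAtPrime p ∧ ¬ (p : ℤ) ∣ W'.frobeniusTrace p) ∨
      W'.HasMultiplicativeReductionAtPrime p := by
  rcases hred with ⟨hgood, hord⟩ | hmult
  · exact Or.inl ⟨(h.hasGoodReductionAtPrime_iff p).mp hgood,
      (h.not_dvd_frobeniusTrace_iff p hgood).mp hord⟩
  · exact Or.inr (X2.IsogenyQuotientLine.hasMultiplicativeReductionAtPrime_of_isIsogenous h hmult)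

/-! ## §1. Galois modules: the image of a RAMIFIED-EVEN kernel line is an UNRAMIFIED-ODD line -/

section KernelLine

variable (g : geomTorsion W (p : ℤ) →+ geomTorsion W' (p : ℤ))
  (hg : ∀ (σ : absoluteGaloisGroup ℚ) (P : geomTorsion W (p : ℤ)), g (σ • P) = σ • g P)

include hg in
/-- **The image of a ramified-even kernel line is an unramified-odd rational line** (the converse
direction of `X2.IsogenyLineType.isRationalLine_range_and_ramified_even_of_ker`; the computation is
the first half of `gvPar_of_ker_line`, which records only `GVPar W' p`). Let `g : E[p] → E'[p]` be
`Γ_ℚ`-equivariant with kernel `K` of order `p` (`#E[p] = p²`, `p` odd); assume (hL) at every prime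
above `p` and (hc) (every complex conjugation has a non-zero fixed and a non-zero anti-fixed point
on `E[p]`). If `K` is RAMIFIED at `p` and EVEN then `g(E[p]) ≅ E[p]/K` is a rational line of `E'[p]`
which is UNRAMIFIED at `p` (at each `𝔓`, `K` is the line `L` of (hL), so `I_𝔓` acts trivially on
`E[p]/K`) and ODD (`c = +1` on `K` and on `E[p]/K` would force `c = 1` on `E[p]`).
[cite: GreenbergVatsal2000, §2 p. 28 (the two cases of the parity hypothesis)] -/
theorem unramified_odd_range_of_ramified_even_ker (hp2 : p ≠ 2)
    (hE : Nat.card (geomTorsion W (p : ℤ)) = p ^ 2)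
    (hL : ∀ (v : HeightOneSpectrum (𝓞 ℚ)), (p : 𝓞 ℚ) ∈ v.asIdeal → ∀ 𝔓 ∈ v.primesAbove,
      ∃ L : AddSubgroup (geomTorsion W (p : ℤ)), Nat.card L = p ∧
        (∀ σ ∈ 𝔓.inertia (absoluteGaloisGroup ℚ), ∀ P : geomTorsion W (p : ℤ), σ • P - P ∈ L) ∧
        (∃ σ ∈ 𝔓.inertia (absoluteGaloisGroup ℚ), ∃ P ∈ L, σ • P ≠ P))
    (hc : ∀ c : absoluteGaloisGroup ℚ, IsComplexConjugation (Rat.castHom ℝ) c →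
      (∃ P : geomTorsion W (p : ℤ), P ≠ 0 ∧ c • P = P) ∧
        (∃ Q : geomTorsion W (p : ℤ), Q ≠ 0 ∧ c • Q = -Q))
    (hK : Nat.card g.ker = p) (hr : ¬ LineUnramifiedAt W p g.ker) (he : LineEven W p g.ker) :
    IsRationalLine W' p g.range ∧ LineUnramifiedAt W' p g.range ∧ LineOdd W' p g.range := by
  have hKline : IsRationalLine W p g.ker := ⟨hK, fun σ P hP ↦ smul_mem_ker g hg hP⟩
  have hΨ : IsRationalLine W' p g.range := isRationalLine_range g hg hE hK
  have hsign : ∀ c : absoluteGaloisGroup ℚ, IsComplexConjugation (Rat.castHom ℝ) c →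
      (∀ y ∈ g.range, c • y = y) ∨ (∀ y ∈ g.range, c • y = -y) :=
    fun c hcc ↦ smul_eq_self_or_eq_neg_of_sq_eq_one hΨ hcc.sq_eq_one
  have hcc2 : ∀ c : absoluteGaloisGroup ℚ, IsComplexConjugation (Rat.castHom ℝ) c →
      ∀ P : geomTorsion W (p : ℤ), c • c • P = P := by
    intro c hcc P
    rw [← mul_smul, ← pow_two, hcc.sq_eq_one, one_smul]
  refine ⟨hΨ, ?_, ?_⟩
  · intro v hv 𝔓 h𝔓 σ hσ y hy
    obtain ⟨P, rfl⟩ := AddMonoidHom.mem_range.mp hy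
    obtain ⟨L, hLcard, hLsub, -⟩ := hL v hv 𝔓 h𝔓
    have hKL : g.ker = L := eq_of_not_lineUnramifiedAt hKline hr hv h𝔓 hLcard hLsub
    have h1 : σ • P - P ∈ g.ker := hKL ▸ hLsub σ hσ P
    rw [AddMonoidHom.mem_ker, map_sub, hg, sub_eq_zero] at h1
    exact h1
  · intro c hcc y hy
    rcases hsign c hcc with hplus | hminus
    · exfalso
      obtain ⟨-, Q, hQ0, hQ⟩ := hc c hcc
      have hall : ∀ P : geomTorsion W (p : ℤ), c • P = P := by
        intro P
        have h1 : c • g P = g P := hplus (g P) (AddMonoidHom.mem_range.mpr ⟨P, rfl⟩)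
        have h2 : c • P - P ∈ g.ker := by
          rw [AddMonoidHom.mem_ker, map_sub, hg, h1, sub_self]
        have h3 : c • (c • P - P) = c • P - P := he c hcc _ h2
        rw [smul_sub, hcc2 c hcc P] at h3
        have h4 : (c • P - P) + (c • P - P) = 0 := by
          have hx : c • P - P = -(c • P - P) := by rw [neg_sub]; exact h3.symm
          nth_rewrite 2 [hx]
          exact add_neg_cancel _
        exact sub_eq_zero.mp (eq_zero_of_add_self_eq_zero hp2 h4)
      have : Q + Q = 0 := by
        have hq := hall Q
        rw [hQ] at hq
        nth_rewrite 1 [← hq]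
        exact neg_add_cancel Q
      exact hQ0 (eq_zero_of_add_self_eq_zero hp2 this)
    · exact hminus y hy

end KernelLine

/-! ## §2. An isogeny on the `p`-torsion: restriction, kernel line, kernel of the dual -/

section Restrict

variable [W.IsElliptic] [W'.IsElliptic]

omit hp [W.IsElliptic] [W'.IsElliptic] in
/-- If `ker ψ = Φ₀` (pushed into `E(ℚ̄)`), the restriction `g` of `ψ` to `E[p]` has `ker g = Φ₀`.
[folklore] -/
theorem ker_restrict_eq (ψ : Isogeny W W') {g : geomTorsion W (p : ℤ) →+ geomTorsion W' (p : ℤ)}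
    (hgval : ∀ P : geomTorsion W (p : ℤ), (g P : geomPoints W') = ψ (P : geomPoints W))
    {Φ₀ : AddSubgroup (geomTorsion W (p : ℤ))}
    (hker : ψ.toAddMonoidHom.ker = Φ₀.map (geomTorsion W (p : ℤ)).subtype) : g.ker = Φ₀ := by
  ext P
  rw [AddMonoidHom.mem_ker]
  constructor
  · intro hP
    have h1 : (P : geomPoints W) ∈ ψ.toAddMonoidHom.ker := by
      rw [AddMonoidHom.mem_ker, Isogeny.coe_toAddMonoidHom, ← hgval, hP]; rfl
    rw [hker] at h1
    obtain ⟨Q, hQ, hQP⟩ := h1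
    have : Q = P := Subtype.ext hQP
    exact this ▸ hQ
  · intro hP
    have h1 : (P : geomPoints W) ∈ ψ.toAddMonoidHom.ker := by
      rw [hker]; exact ⟨P, hP, rfl⟩
    rw [AddMonoidHom.mem_ker, Isogeny.coe_toAddMonoidHom, ← hgval] at h1
    exact Subtype.ext h1

omit hp in
/-- **The kernel of the dual is the image of the `p`-torsion.** For `ψ : E → E'` and `f : E' → E`
with `f ∘ ψ = [p]` on `E(ℚ̄)`, `ker f = ψ(E[p])` (pushed into `E'(ℚ̄)`), `ψ` being onto
(*AEC* II.2.3). [cite: SilvermanAEC2009, Thm. III.6.1 and Thm. II.2.3] -/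
theorem ker_dual_eq_map_range (ψ : Isogeny W W') (f : Isogeny W' W)
    (hf : ∀ P : geomPoints W, f (ψ P) = (p : ℤ) • P)
    {g : geomTorsion W (p : ℤ) →+ geomTorsion W' (p : ℤ)}
    (hgval : ∀ P : geomTorsion W (p : ℤ), (g P : geomPoints W') = ψ (P : geomPoints W)) :
    f.toAddMonoidHom.ker = g.range.map (geomTorsion W' (p : ℤ)).subtype := by
  ext Q
  rw [AddMonoidHom.mem_ker, Isogeny.coe_toAddMonoidHom]
  constructor
  · intro hQ
    obtain ⟨P, rfl⟩ := ψ.surjective Q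
    have hP : P ∈ geomTorsion W (p : ℤ) := by
      rw [mem_geomTorsion_iff, ← hf P]; exact hQ
    exact ⟨g ⟨P, hP⟩, AddMonoidHom.mem_range.mpr ⟨⟨P, hP⟩, rfl⟩, hgval ⟨P, hP⟩⟩
  · rintro ⟨y, hy, rfl⟩
    obtain ⟨P, rfl⟩ := AddMonoidHom.mem_range.mp hy
    rw [AddSubgroup.coe_subtype, hgval, hf, ← mem_geomTorsion_iff]
    exact P.2

end Restrict

/-! ## §3. Isogenies of degree prime to `p` change the period by a `p`-adic unit -/

section PrimeToP

/-- **An isogeny of degree prime to `p` between globally minimal models changes the Néron real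
period by a `p`-adic unit** (Greenberg–Vatsal Remark (3.4), bookkeeping): `q · Ω(E) = a · Ω(E')`
with `q ∣ d`, `ab = d` (`SkinnerUrban2014.exists_int_mul_realPeriodRat_eq_of_isogeny`, Néron
integrality of the multiplier), so `Ω(E') = (q/a)·Ω(E)` with `p ∤ q`, `p ∤ a` (`BinaryQuartic.norm_intCast_eq_one`). The modular
parametrisation data enter only through their Néron lattices; the newform is carried along the
isogeny (`IsNewformOf.of_isIsogenous`). [cite: GreenbergVatsal2000, §3, Remark 3.4]
[cite: SilvermanAEC2009, Thm. VI.4.1(b)] -/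
theorem exists_unit_of_not_dvd_degree [W.IsElliptic] [W'.IsElliptic] [W.IsGloballyMinimal]
    [W'.IsGloballyMinimal] {N : ℕ} [NeZero N] {f : CuspForm (Gamma0 N) 2} (hf : IsNewformOf W f)
    (ψ : Isogeny W W') (hpd : ¬ p ∣ ψ.degree) :
    ∃ u : ℚ, ‖(u : ℚ_[p])‖ = 1 ∧ W'.realPeriodRat = (u : ℝ) * W.realPeriodRat := by
  have hpP : p.Prime := hp.out
  have hiso : IsIsogenous W W' := ⟨ψ⟩
  have hf' : IsNewformOf W' f := hf.of_isIsogenous hiso.symm_of_charZero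
  obtain ⟨D⟩ := Literature.NumberTheory.Automorphic.nonempty_modularParametrizationData_of_isNewformOf hf
  obtain ⟨D'⟩ :=
    Literature.NumberTheory.Automorphic.nonempty_modularParametrizationData_of_isNewformOf hf'
  obtain ⟨q, a, b, hq0, hqd, hab, hqa⟩ :=
    Literature.NumberTheory.EllipticCurves.SkinnerUrban2014.exists_int_mul_realPeriodRat_eq_of_isogeny
      D D' ψ
  have hd0 : (ψ.degree : ℤ) ≠ 0 := by exact_mod_cast ψ.degree_pos.ne'
  have ha0 : a ≠ 0 := by
    rintro rfl
    exact hd0 (by rw [← hab, zero_mul])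
  have hpq : ¬ (p : ℤ) ∣ q := fun h ↦ hpd (Int.natCast_dvd_natCast.mp (h.trans hqd))
  have hpa : ¬ (p : ℤ) ∣ a := fun h ↦ hpd (Int.natCast_dvd_natCast.mp (hab ▸ h.mul_right b))
  have hpos : 0 < W'.realPeriodRat := by
    haveI : (W'.baseChange ℝ).IsElliptic := by
      rw [WeierstrassCurve.baseChange]; infer_instance
    exact (W'.baseChange ℝ).realPeriod_pos'
  refine ⟨(q : ℚ) / (a : ℚ), ?_, ?_⟩
  · have e : (((q : ℚ) / (a : ℚ) : ℚ) : ℚ_[p]) = (q : ℚ_[p]) / (a : ℚ_[p]) := by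
      simp only [Rat.cast_div, Rat.cast_intCast]
    rw [e, norm_div, BinaryQuartic.norm_intCast_eq_one hpq, BinaryQuartic.norm_intCast_eq_one hpa,
      div_one]
  · have ha0' : (a : ℝ) ≠ 0 := by exact_mod_cast ha0
    have hcast : (((q : ℚ) / (a : ℚ) : ℚ) : ℝ) = (q : ℝ) / (a : ℝ) := by
      simp only [Rat.cast_div, Rat.cast_intCast]
    rw [hcast, div_mul_eq_mul_div, eq_div_iff ha0', mul_comm (W'.realPeriodRat), hqa]

end PrimeToP

/-! ## §4. Factorisation through an isogeny (Silverman III.4.11) and the kernel count -/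

section Factor

variable {W₂ : WeierstrassCurve ℚ} [W.IsElliptic] [W₂.IsElliptic]

/-- **Silverman III.4.11 over `ℚ`**: an isogeny `ψ : E → E'` killing `ker g` factors through
`g : E → E₂` — every isogeny is separable in characteristic `0`
(`Isogeny.exists_eq_comp_of_ker_le_of_isSeparable`). [cite: SilvermanAEC2009, Cor. III.4.11] -/
theorem exists_factor_of_ker_le (g : Isogeny W W₂) (ψ : Isogeny W W')
    (hle : ∀ P : geomPoints W, g P = 0 → ψ P = 0) :
    ∃ lam : Isogeny W₂ W', ∀ P, ψ P = lam (g P) := by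
  haveI : FiniteDimensional g.pullbackField W.geomFunctionField :=
    Isogeny.finiteDimensional_pullbackField_holds W W₂ g
  haveI : CharZero W.geomFunctionField :=
    charZero_of_injective_ringHom (algebraMap ℚ W.geomFunctionField).injective
  haveI : CharZero g.pullbackField := (algebraMap g.pullbackField W.geomFunctionField).charZero
  haveI : Algebra.IsSeparable g.pullbackField W.geomFunctionField :=
    Algebra.IsAlgebraic.isSeparable_of_perfectField
  exact g.exists_eq_comp_of_ker_le_of_isSeparable ψ hle

/-- **Kernel count of a factorisation `ψ = λ ∘ g`**: `#ker ψ = #ker λ · #ker g` (first isomorphism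
theorem for `g|_{ker ψ}`, `g` onto: `ker λ = g(ker ψ)`, `ker ψ ⊓ ker g = ker g`).
[cite: SilvermanAEC2009, Cor. III.4.11] -/
theorem natCard_ker_eq_mul_of_factor (g : Isogeny W W₂) (ψ : Isogeny W W') (lam : Isogeny W₂ W')
    (hfac : ∀ P, ψ P = lam (g P)) :
    Nat.card ψ.toAddMonoidHom.ker =
      Nat.card lam.toAddMonoidHom.ker * Nat.card g.toAddMonoidHom.ker := by
  have hmap : ψ.toAddMonoidHom.ker.map g.toAddMonoidHom = lam.toAddMonoidHom.ker := by
    ext Q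
    rw [AddSubgroup.mem_map]
    constructor
    · rintro ⟨P, hP, rfl⟩
      rw [AddMonoidHom.mem_ker, Isogeny.coe_toAddMonoidHom] at hP ⊢
      rw [Isogeny.coe_toAddMonoidHom, ← hfac, hP]
    · intro hQ
      obtain ⟨P, rfl⟩ := g.surjective Q
      rw [AddMonoidHom.mem_ker, Isogeny.coe_toAddMonoidHom] at hQ
      refine ⟨P, ?_, rfl⟩
      rw [AddMonoidHom.mem_ker, Isogeny.coe_toAddMonoidHom, hfac, hQ]
  have hinf : ψ.toAddMonoidHom.ker ⊓ g.toAddMonoidHom.ker = g.toAddMonoidHom.ker := by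
    refine inf_eq_right.mpr fun P hP ↦ ?_
    rw [AddMonoidHom.mem_ker, Isogeny.coe_toAddMonoidHom] at hP ⊢
    rw [hfac, hP, map_zero]
  rw [natCard_eq_natCard_map_mul_natCard_inf_ker g.toAddMonoidHom ψ.toAddMonoidHom.ker, hmap, hinf]

/-- **Two isogenies with the same kernel differ by an isogeny of degree `1`**
(*AEC* III.4.11 / III.4.12, uniqueness of the quotient). [cite: SilvermanAEC2009, Cor. III.4.11] -/
theorem exists_degree_one_of_ker_eq (g : Isogeny W W₂) (ψ : Isogeny W W')
    (hker : g.toAddMonoidHom.ker = ψ.toAddMonoidHom.ker) :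
    ∃ lam : Isogeny W₂ W', lam.degree = 1 ∧ ∀ P, ψ P = lam (g P) := by
  have hle : ∀ P : geomPoints W, g P = 0 → ψ P = 0 := fun P hP ↦ by
    have h : P ∈ ψ.toAddMonoidHom.ker := by
      rw [← hker, AddMonoidHom.mem_ker, Isogeny.coe_toAddMonoidHom]; exact hP
    rwa [AddMonoidHom.mem_ker, Isogeny.coe_toAddMonoidHom] at h
  obtain ⟨lam, hfac⟩ := exists_factor_of_ker_le g ψ hle
  refine ⟨lam, ?_, hfac⟩
  have h := natCard_ker_eq_mul_of_factor g ψ lam hfac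
  rw [← hker] at h
  have hg0 : Nat.card g.toAddMonoidHom.ker ≠ 0 := g.degree_pos.ne'
  unfold Isogeny.degree
  -- `#ker g = #ker λ · #ker g`
  nth_rewrite 1 [← one_mul (Nat.card g.toAddMonoidHom.ker)] at h
  exact (Nat.eq_of_mul_eq_mul_right (Nat.pos_of_ne_zero hg0) h).symm

end Factor

end Summit.BirchSwinnertonDyer.Rank1Residual.GVPeriod

end
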